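import Mathlib
import Summits.NavierStokesRegularity.NavierStokesRegularity.Theses.RootDecompLitSlice
import Summits.NavierStokesRegularity.NavierStokesRegularity.Theorems.RootDecompLitSliceFourFifthsVisibleScarClosed
import HarnessLib

/-!
# Route RootDecompLitSlice — aside `TwoThirdsTameScarIsCritical` CLOSED (stmt-NavierStokesRegularity-27392)

`Summit.NavierStokesRegularity.NavierStokesRegularity.Theses.RootDecompLitSlice.TwoThirdsTameScarIsCritical`
— «(2/3)-clock-tame solutions have critical scars» on the classical Leray–Hopf frame (classical on
`[0,T)`, Leray–Hopf on `[0,T]`, rapidly decaying datum): clock `∫|u(t)−u(T)|² ≤ K(T−t)^{2/3}` near `T`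
⟹ `r⁻¹∫_{B_r(x₀)}|u(T)|² ≤ M` for small `r`, at every `x₀` (Uᶜ's conclusion in U's own `r⁻¹`-form,
for the clock exponent `2/3`) — is the clock→scar transfer law `ClockScarLaw.clockScarRung`
(`RootDecompLitSliceFourFifthsVisibleScarClosed.lean`, unconditional since STg ⟨27390⟩ landed) at
`b = 2/3`: `4·(2/3)/(2/3+2) = 1`, window `τ = r^{3/2}`. Port of the writer g32 kernel
`WriterG32.twoThirdsTameScarIsCritical_of_generalWindow` (evidence file ScarExponentDial_g32.lean,
sha256 a2b70d2daa73) with its hypothesis discharged.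

Also recorded (writer g32 bookkeeping, same file): `critTame_of_twoThirdsClock` — the (2/3)-clock
class lies INSIDE Uᶜ's hypothesis class (`(T−t)^{2/3} ≤ √(T−t)` once `T−t ≤ 1`), and
`twoThirdsClockCell` — the literal sub-cell of U on the MAXIMAL-SMOOTH frame («a tame first blow-up
on the (2/3)-clock has critical scars», U's frame and conclusion verbatim plus the clock hypothesis)
is a theorem: a maximal smooth solution is classical on `[0,T)`.

HONEST FRAMING: an ASIDE of the route (kind aside, rank 9; banked context, never staffed — NAMED-RUNG
RULE): a CLOSED SUB-CELL of the Tao-vacuous cell Uᶜ `CritTameScarIsCritical` ⟨31733⟩; Tao's cascade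
(`b ≈ 0.008`) and every abrupt blow-up stay in Uᵃ, no load of the route moves (ROOT ⟺ U ∧ P1,
critic rows 354/371/563). Rung 0: nothing here proves NS regularity. Decomp-ns route-writer g36.
[folklore]
-/

set_option linter.dupNamespace false

namespace Summit.NavierStokesRegularity.NavierStokesRegularity.Theorems

open MeasureTheory Set
open scoped ENNReal

/-- **Aside `TwoThirdsTameScarIsCritical` of route RootDecompLitSlice, by name**: the clock→scar law
`ClockScarLaw.clockScarRung` at `b = 2/3` (`α = 1`). Banked aside; decorative for the summit
(D-0179). [folklore] -/
theorem twoThirdsTameScarIsCritical :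
    Summit.NavierStokesRegularity.NavierStokesRegularity.Theses.RootDecompLitSlice.TwoThirdsTameScarIsCritical := by
  intro ν T hν hT u p hcl hLH hdec hclock x₀
  obtain ⟨C, r₁, hr₁, hC⟩ :=
    ClockScarLaw.clockScarRung (b := 2 / 3) (by norm_num) (by norm_num)
      ν T hν hT u p hcl hLH hdec hclock x₀
  refine ⟨C, r₁, hr₁, fun r hr => ?_⟩
  have h1 := hC r hr
  rw [show (4 * (2 / 3 : ℝ) / (2 / 3 + 2)) = 1 by norm_num, Real.rpow_one] at h1
  exact (inv_mul_le_iff₀ hr.1).2 (h1.trans (le_of_eq (mul_comm C r)))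

namespace TwoThirdsTameScarIsCritical

/-- The (2/3)-clock class lies INSIDE Uᶜ's hypothesis class (the critical clock `b = 1/2`):
`(T−t)^{2/3} ≤ √(T−t)` once `T − t ≤ 1`. [folklore] -/
theorem critTame_of_twoThirdsClock {T : ℝ}
    {u : ℝ → EuclideanSpace ℝ (Fin 3) → EuclideanSpace ℝ (Fin 3)}
    (h : ∃ K T₁ : ℝ, T₁ < T ∧ ∀ t ∈ Set.Ioo T₁ T,
      ∫⁻ x, ‖u t x - u T x‖ₑ ^ 2 ≤ ENNReal.ofReal (K * (T - t) ^ (2 / 3 : ℝ))) :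
    ∃ K T₁ : ℝ, T₁ < T ∧ ∀ t ∈ Set.Ioo T₁ T,
      ∫⁻ x, ‖u t x - u T x‖ₑ ^ 2 ≤ ENNReal.ofReal (K * Real.sqrt (T - t)) := by
  obtain ⟨K, T₁, hT₁, hK⟩ := h
  refine ⟨max K 0, max T₁ (T - 1), max_lt hT₁ (by linarith), fun t ht => ?_⟩
  have ht₁ : T₁ < t := lt_of_le_of_lt (le_max_left _ _) ht.1
  have ht1 : T - 1 < t := lt_of_le_of_lt (le_max_right _ _) ht.1
  have h0 : 0 < T - t := sub_pos.mpr ht.2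
  have h1 : T - t ≤ 1 := by linarith
  refine (hK t ⟨ht₁, ht.2⟩).trans (ENNReal.ofReal_le_ofReal ?_)
  have hpow : (T - t) ^ (2 / 3 : ℝ) ≤ Real.sqrt (T - t) := by
    rw [Real.sqrt_eq_rpow]
    exact Real.rpow_le_rpow_of_exponent_ge h0 h1 (by norm_num)
  calc K * (T - t) ^ (2 / 3 : ℝ) ≤ max K 0 * (T - t) ^ (2 / 3 : ℝ) :=
        mul_le_mul_of_nonneg_right (le_max_left _ _) (Real.rpow_nonneg h0.le _)
    _ ≤ max K 0 * Real.sqrt (T - t) := mul_le_mul_of_nonneg_left hpow (le_max_right _ _)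

/-- The LITERAL SUB-CELL of U/Uᶜ on the maximal-smooth frame is a theorem: «a tame first blow-up on
the (2/3)-clock has critical scars» (U's frame — maximal smooth solution, Leray–Hopf on `[0,T]`,
rapidly decaying datum, `L²`-tame at `T` — and U's conclusion VERBATIM, plus the clock hypothesis;
tameness is not even used: a maximal smooth solution is classical on `[0,T)`). [folklore] -/
theorem twoThirdsClockCell :
    ∀ (ν T : ℝ), 0 < ν → 0 < T →
    ∀ (u : ℝ → EuclideanSpace ℝ (Fin 3) → EuclideanSpace ℝ (Fin 3))
      (p : ℝ → EuclideanSpace ℝ (Fin 3) → ℝ),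
      Literature.Analysis.FluidPDE.IsMaximalSmoothSolution ν 0 u p T →
      Literature.Analysis.FluidPDE.IsLerayHopfOn T ν 0 (u 0) u →
      Literature.Analysis.FluidPDE.HasRapidSpatialDecay (u 0) →
      Filter.Tendsto (fun t => MeasureTheory.eLpNorm (u t - u T) 2 MeasureTheory.volume)
        (nhdsWithin T (Set.Iio T)) (nhds 0) →
      (∃ K T₁ : ℝ, T₁ < T ∧ ∀ t ∈ Set.Ioo T₁ T,
        ∫⁻ x, ‖u t x - u T x‖ₑ ^ 2 ≤ ENNReal.ofReal (K * (T - t) ^ (2 / 3 : ℝ))) →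
      ∀ x₀ : EuclideanSpace ℝ (Fin 3), ∃ M r₁ : ℝ, 0 < r₁ ∧ ∀ r ∈ Set.Ioo 0 r₁,
        r⁻¹ * ∫ x in Metric.ball x₀ r, ‖u T x‖ ^ 2 ≤ M :=
  fun ν T hν hT u p hmax hLH hdec _ hclock x₀ =>
    twoThirdsTameScarIsCritical ν T hν hT u p hmax.1 hLH hdec hclock x₀

end TwoThirdsTameScarIsCritical

end Summit.NavierStokesRegularity.NavierStokesRegularity.Theorems
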